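import Summits.ValiantsHypothesis.ValiantsHypothesis.Theses.BorderApolarity
import Literature.Computability.AlgebraicComplexity.Apolarity
import Literature.Computability.AlgebraicComplexity.ApolarityAction
import Literature.Barriers.ValiantsHypothesis.PartialDerivativesDetPerm
import Summits.ValiantsHypothesis.ValiantsHypothesis.Theorems.BorderApolarityFixedWitnessObstructionQPAnnSubmodule
import Summits.ValiantsHypothesis.ValiantsHypothesis.Theorems.BorderApolarityFixedWitnessObstructionQPLimitIdeal
import Summits.ValiantsHypothesis.ValiantsHypothesis.Theorems.BorderApolarityFixedWitnessObstructionQPH0Elementary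
import Summits.ValiantsHypothesis.ValiantsHypothesis.Theorems.BorderApolarityFixedWitnessObstructionQPConePurity
import Mathlib.LinearAlgebra.Matrix.Permanent

/-!
# Crux `FixedWitnessObstructionQP`, line `cone-purity-squeeze` — the climb is FALSE without its border clauses

Negative lemma (refuter, drefute gen 2) for the hardest stub `stub_pureBorderObstruction` ("the
climb") of the skeleton `Cruxes/FixedWitnessObstructionQP/Lines/cone-purity-squeeze.lean`
(crux item `stmt-ValiantsHypothesis-5778`, route `ValiantsHypothesis/BorderApolarity`).

The climb says: for every `c` there is `n₀` such that for `n ≥ n₀`, `n ≤ m ≤ 2^((log₂ n + c)^c)`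
there is NO pair `(P, J)` with
(W1) `P t ∈ GL_{m²}·det_m`, (W2 ∧ W3) `IsBorderApolarLimit m P J`, (W4) `J` is `H₀(n,m)`-stable,
(W5) `J k ⌟ ℓ^{m-n} per_n = 0` (`k ≤ m`), and the PURE NORMAL FORM (N1) `J k` is a subspace of the
degree-`k` forms of dimension `C(m²+k-1,k) - C(m,k)²`, (N2) `J k · Xᵢ ⊆ J (k+1)`, (N3) cone purity in
the budget-pure degrees.  The five infrastructure stubs of the line (all landed:
`…Theorems.BorderApolarityFixedWitnessObstructionQP.stub_*`) prove N1–N3 for every witness of the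
crux, so the climb is kernel-equivalent to the crux.

**What is proved here.**  `PureBorderObstructionWithoutBorder` := the climb with the three BORDER
clauses W1, W2, W3 deleted (and with them the approximating sequence `P`), every other conjunct
VERBATIM.  It implies the climb (`climb_of_pureBorderObstructionWithoutBorder`, by weakening) — and it
is FALSE: `not_pureBorderObstructionWithoutBorder`.  Sharper: EVERY slice `c ≥ 1` of it fails
(`not_pureBorderObstructionWithoutBorder_slice`), whereas the slice `c = 1` of the climb itself is a
theorem (Landsberg–Manivel–Ressayre 2013 via `WitnessToMembership`, see the crux's `Disproof.lean` §2/§8)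
and `c ≥ 2` is its open content.

**Witness** (`abstractPureWitness_self`): at the corner `m = n` of the window (allowed for every
`c ≥ 1`), `J k := Ann_k(per_n)`.  Indeed `paddedPerPoly ℂ n n = per_n` (`paddedPerPoly_self`);
N1 is the coincidence of Hilbert functions `dim Ann_k(per_n) = dim Ann_k(det_n) = C(n²+k-1,k) - C(n,k)²`
(`Literature.Barriers.ValiantsHypothesis.flatteningRank_perPoly`, Landsberg 2017 §6.2.2/§10.4.4 — the
`PartialDerivativesDetPerm` barrier biting the border-free statement); N2: annihilators are ideals
(`X_mul_mem_annihilatorOfDegree`); W4: the encoded group `H₀(n,n)` is the rank-one torus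
`x_ij ↦ aᵢbⱼx_ij` (extracted from the four matrix conditions exactly as in `Disproof.lean` §11 for
`det`), and `per(aᵢbⱼx_ij) = (∏a)(∏b)·per` (`linSubst_rankOneDiag_perPoly`), so `Ann(per_n)` is
`H₀(n,n)`-stable (`apolarAction_linSubst_eq_zero_iff`); W5 by definition; N3 from N1 + W4 by the landed
`stub_h0Elementary` + `stub_conePurity` (at `m = n` there are no unused variables and the budget-pure
degrees are `k ≤ 1`, where `Ann_k(per_n) = 0`).

**Meaning for the lead.**  W1–W3 are JOINTLY LOAD-BEARING in the climb even at the bottom corner of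
the window: the border-free conjuncts N1–N3 + W4 + W5 cannot even reproduce the LMR bound
`m ≥ n²/2`; no argument from Hilbert function + ideal + `H₀`-stability + purity + apolarity alone
(Macaulay/Gotzmann growth, Green/Eliahou–Kervaire strongly-stable combinatorics applied to these data)
proves the climb — the determinant's border geometry (W1–W3) must enter beyond its Hilbert function.
For `m ≫ n` (`m ≥ ~n³/2`, and at `(3,10)`, `(4,64)`, `(8,256)`) the same statement fails by the
planner's lex-segment ⊕ free-top hybrid (line card § "Why the border clauses stay"); the present
corner witness is the part of that picture that is cheap to kernel-check.
-/

open MvPolynomial Filter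
open scoped BigOperators Matrix
open Literature.Computability.AlgebraicComplexity
open Literature.Barriers.ValiantsHypothesis (flatteningRank_perPoly)
open Summit.ValiantsHypothesis.ValiantsHypothesis.Theorems.BorderApolarityFixedWitnessObstructionQP

namespace Summit.ValiantsHypothesis.ValiantsHypothesis.Theorems.FixedWitnessObstructionQP.Negative

noncomputable section

/-! ## The statements -/

/-- **Abstract pure witness** at `(n, m)`: a family `J` with the climb's conjuncts W4 (H₀(n,m)-stability,
verbatim), W5 (apolarity to the padded permanent, verbatim), N1 (subspace of degree-`k` forms with the
determinant's Hilbert function), N2 (ideal truncation), N3 (cone purity in budget-pure degrees) — i.e.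
the `∃`-body of `stub_pureBorderObstruction` with W1 (`P t ∈ GL·det_m`) and W2 ∧ W3
(`IsBorderApolarLimit m P J`) deleted. [folklore] -/
def AbstractPureWitnessExists (n m : ℕ) [NeZero m] : Prop :=
  ∃ (J : ℕ → Set (MvPolynomial (Fin m × Fin m) ℂ)),
    (∀ A : Matrix.GeneralLinearGroup (Fin m × Fin m) ℂ,
      let M : Matrix (Fin m × Fin m) (Fin m × Fin m) ℂ := A
      let rk := fun (p : Fin m × Fin m) =>
        (if (m - n ≤ (p.1 : ℕ) ∧ m - n ≤ (p.2 : ℕ)) ∨ p = (0, 0) then 0 else m * m) +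
          ((p.1 : ℕ) * m + (p.2 : ℕ))
      (∀ i j : Fin m × Fin m, M j i ≠ 0 → rk j ≤ rk i) →
      (∀ i j : Fin m × Fin m, ((m - n ≤ (i.1 : ℕ) ∧ m - n ≤ (i.2 : ℕ)) ∨ i = (0, 0)) → j ≠ i → M j i = 0) →
      (∀ i k j l : Fin m, m - n ≤ (i : ℕ) → m - n ≤ (k : ℕ) → m - n ≤ (j : ℕ) → m - n ≤ (l : ℕ) →
        M (i, j) (i, j) * M (k, l) (k, l) = M (i, l) (i, l) * M (k, j) (k, j)) →
      M (0, 0) (0, 0) ^ (m - n) * ∏ i ∈ Finset.univ.filter (fun i : Fin m => m - n ≤ (i : ℕ)), M (i, i) (i, i) = 1 →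
      ∀ k ≤ m, ∀ D ∈ J k, linSubst (Fin m × Fin m) ℂ Mᵀ D ∈ J k) ∧
    (∀ k ≤ m, ∀ D ∈ J k, apolarAction D (paddedPerPoly ℂ n m) = 0) ∧
    (∀ k ≤ m, ∃ Jk : Submodule ℂ (MvPolynomial (Fin m × Fin m) ℂ),
      (Jk : Set (MvPolynomial (Fin m × Fin m) ℂ)) = J k ∧
      Jk ≤ MvPolynomial.homogeneousSubmodule (Fin m × Fin m) ℂ k ∧
      Module.finrank ℂ Jk = Nat.choose (m * m + k - 1) k - (Nat.choose m k) ^ 2) ∧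
    (∀ k : ℕ, k + 1 ≤ m → ∀ D ∈ J k, ∀ i : Fin m × Fin m, D * MvPolynomial.X i ∈ J (k + 1)) ∧
    (∀ k ≤ m, Nat.choose (m * m + k - 1) k < Nat.choose (m * m - n * n - 2 + k) k + (Nat.choose m k) ^ 2 →
      ∀ D ∈ J k, (∀ s ∈ D.support, ∀ v : Fin m × Fin m,
        ¬ ((m - n ≤ (v.1 : ℕ) ∧ m - n ≤ (v.2 : ℕ)) ∨ v = (0, 0)) → s v = 0) → D = 0)

/-- **The climb without its border clauses**: `stub_pureBorderObstruction` of line `cone-purity-squeeze`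
with W1, W2, W3 (and the sequence `P`) deleted — "no abstract pure witness in the quasi-polynomial
window".  FALSE: `not_pureBorderObstructionWithoutBorder`. [folklore] -/
def PureBorderObstructionWithoutBorder : Prop :=
  ∀ c : ℕ, ∃ n₀ : ℕ, ∀ n ≥ n₀, ∀ (m : ℕ) [NeZero m], n ≤ m → m ≤ 2 ^ ((Nat.log 2 n + c) ^ c) →
    ¬ AbstractPureWitnessExists n m

/-- The climb `stub_pureBorderObstruction` of `Lines/cone-purity-squeeze.lean`, restated verbatim
(the skeleton is a work file and is not imported). [folklore] -/
def Climb : Prop :=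
  ∀ c : ℕ, ∃ n₀ : ℕ, ∀ n ≥ n₀, ∀ (m : ℕ) [NeZero m], n ≤ m → m ≤ 2 ^ ((Nat.log 2 n + c) ^ c) →
    ¬ ∃ (P : ℕ → MvPolynomial (Fin m × Fin m) ℂ) (J : ℕ → Set (MvPolynomial (Fin m × Fin m) ℂ)),
      (∀ t : ℕ, P t ∈ glOrbit (Fin m × Fin m) ℂ (detPoly (Fin m) ℂ)) ∧
      IsBorderApolarLimit m P J ∧
      (∀ A : Matrix.GeneralLinearGroup (Fin m × Fin m) ℂ,
        let M : Matrix (Fin m × Fin m) (Fin m × Fin m) ℂ := A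
        let rk := fun (p : Fin m × Fin m) =>
          (if (m - n ≤ (p.1 : ℕ) ∧ m - n ≤ (p.2 : ℕ)) ∨ p = (0, 0) then 0 else m * m) +
            ((p.1 : ℕ) * m + (p.2 : ℕ))
        (∀ i j : Fin m × Fin m, M j i ≠ 0 → rk j ≤ rk i) →
        (∀ i j : Fin m × Fin m, ((m - n ≤ (i.1 : ℕ) ∧ m - n ≤ (i.2 : ℕ)) ∨ i = (0, 0)) → j ≠ i → M j i = 0) →
        (∀ i k j l : Fin m, m - n ≤ (i : ℕ) → m - n ≤ (k : ℕ) → m - n ≤ (j : ℕ) → m - n ≤ (l : ℕ) →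
          M (i, j) (i, j) * M (k, l) (k, l) = M (i, l) (i, l) * M (k, j) (k, j)) →
        M (0, 0) (0, 0) ^ (m - n) * ∏ i ∈ Finset.univ.filter (fun i : Fin m => m - n ≤ (i : ℕ)), M (i, i) (i, i) = 1 →
        ∀ k ≤ m, ∀ D ∈ J k, linSubst (Fin m × Fin m) ℂ Mᵀ D ∈ J k) ∧
      (∀ k ≤ m, ∀ D ∈ J k, apolarAction D (paddedPerPoly ℂ n m) = 0) ∧
      (∀ k ≤ m, ∃ Jk : Submodule ℂ (MvPolynomial (Fin m × Fin m) ℂ),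
        (Jk : Set (MvPolynomial (Fin m × Fin m) ℂ)) = J k ∧
        Jk ≤ MvPolynomial.homogeneousSubmodule (Fin m × Fin m) ℂ k ∧
        Module.finrank ℂ Jk = Nat.choose (m * m + k - 1) k - (Nat.choose m k) ^ 2) ∧
      (∀ k : ℕ, k + 1 ≤ m → ∀ D ∈ J k, ∀ i : Fin m × Fin m, D * MvPolynomial.X i ∈ J (k + 1)) ∧
      (∀ k ≤ m, Nat.choose (m * m + k - 1) k < Nat.choose (m * m - n * n - 2 + k) k + (Nat.choose m k) ^ 2 →
        ∀ D ∈ J k, (∀ s ∈ D.support, ∀ v : Fin m × Fin m,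
          ¬ ((m - n ≤ (v.1 : ℕ) ∧ m - n ≤ (v.2 : ℕ)) ∨ v = (0, 0)) → s v = 0) → D = 0)

/-- The border-free statement is a STRENGTHENING of the climb (it forgets W1–W3), so its falsity is
information about which hypotheses a proof of the climb must use, not a refutation. [folklore] -/
theorem climb_of_pureBorderObstructionWithoutBorder (h : PureBorderObstructionWithoutBorder) : Climb := by
  intro c
  obtain ⟨n₀, hn₀⟩ := h c
  refine ⟨n₀, fun n hn m _ hnm hm => ?_⟩
  rintro ⟨P, J, -, -, hW4, hW5, hN1, hN2, hN3⟩
  exact hn₀ n hn m hnm hm ⟨J, hW4, hW5, hN1, hN2, hN3⟩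

/-! ## The corner `m = n`: `paddedPerPoly ℂ n n = per_n`, torus semi-invariance of `per` -/

/-- At `m = n` the padding is empty and the block is everything: `X₀₀^0 · per_n(block) = per_n`.
[folklore] -/
theorem paddedPerPoly_self (n : ℕ) [NeZero n] : paddedPerPoly ℂ n n = perPoly (Fin n) ℂ := by
  classical
  have hB : ∀ i : Fin n, n - n ≤ (i : ℕ) := fun i => by simp
  let e : BlockIdx n n ≃ Fin n := Equiv.subtypeUnivEquiv hB
  have h1 : (X ((0 : Fin n), (0 : Fin n)) : MvPolynomial (Fin n × Fin n) ℂ) ^ (n - n) = 1 := by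
    rw [Nat.sub_self, pow_zero]
  rw [paddedPerPoly, h1, one_mul, perPoly, perPoly, Matrix.permanent, Matrix.permanent, map_sum]
  simp only [map_prod, Matrix.mvPolynomialX_apply, rename_X]
  rw [← Equiv.sum_comp (Equiv.permCongr e)]
  refine Finset.sum_congr rfl fun σ _ => ?_
  rw [← Equiv.prod_comp e]
  refine Finset.prod_congr rfl fun i _ => ?_
  simp [e, Equiv.permCongr_apply, Equiv.subtypeUnivEquiv]

/-- **Torus semi-invariance of the permanent**: `per(aᵢ bⱼ x_ij) = (∏ aᵢ)(∏ bⱼ) · per(x)`. [folklore] -/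
theorem linSubst_rankOneDiag_perPoly {K : Type*} [Field K] {ι : Type*} [Fintype ι] [DecidableEq ι]
    (a b : ι → K) :
    linSubst (ι × ι) K (Matrix.diagonal fun p : ι × ι => a p.1 * b p.2) (perPoly ι K) =
      ((∏ i, a i) * ∏ j, b j) • perPoly ι K := by
  classical
  have hX : ∀ p : ι × ι,
      linSubst (ι × ι) K (Matrix.diagonal fun p : ι × ι => a p.1 * b p.2) (X p) = C (a p.1 * b p.2) * X p := by
    intro p
    rw [linSubst_X, Finset.sum_eq_single p]
    · rw [Matrix.diagonal_apply_eq, smul_eq_C_mul]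
    · intro q _ hq
      rw [Matrix.diagonal_apply_ne _ hq, zero_smul]
    · intro h
      exact absurd (Finset.mem_univ p) h
  rw [perPoly, Matrix.permanent, map_sum, Finset.smul_sum]
  refine Finset.sum_congr rfl fun σ _ => ?_
  rw [map_prod]
  simp only [Matrix.mvPolynomialX_apply, hX]
  rw [Finset.prod_mul_distrib, ← map_prod, ← smul_eq_C_mul]
  congr 1
  rw [Finset.prod_mul_distrib, Equiv.prod_comp σ a]

/-- **`Ann(per_n)` is stable under the rank-one torus**: if `D ⌟ per = 0` then `(T·D) ⌟ per = 0` for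
`T = diag(aᵢbⱼ)` with nonzero `a, b` (transport of annihilators + semi-invariance). [folklore] -/
theorem apolarAction_rankOneDiag_perPoly {K : Type*} [Field K] {ι : Type*} [Fintype ι] [DecidableEq ι]
    {D : MvPolynomial (ι × ι) K} (hD : apolarAction D (perPoly ι K) = 0) {a b : ι → K}
    (ha : ∀ i, a i ≠ 0) (hb : ∀ j, b j ≠ 0) :
    apolarAction (linSubst (ι × ι) K (Matrix.diagonal fun p : ι × ι => a p.1 * b p.2) D) (perPoly ι K) = 0 := by
  have hunit : IsUnit (Matrix.diagonal fun p : ι × ι => a p.1 * b p.2).det := by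
    rw [Matrix.det_diagonal, isUnit_iff_ne_zero, Finset.prod_ne_zero_iff]
    intro p _
    exact mul_ne_zero (ha _) (hb _)
  have h := apolarAction_linSubst_eq_zero_iff (Matrix.diagonal fun p : ι × ι => a p.1 * b p.2) hunit D
    (perPoly ι K)
  rw [Matrix.diagonal_transpose] at h
  rw [← h, linSubst_rankOneDiag_perPoly, apolarAction_smul_right, hD, smul_zero]

/-- **`H₀(n,n)` is the rank-one torus and `Ann(per_n)` is `H₀(n,n)`-stable** (the clause W4 of the
climb, verbatim, for `J k = Ann_k(per_n)` at `m = n`): the four matrix conditions force `M` to be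
diagonal with `M_(ij)(ij) = aᵢ bⱼ`, all nonzero; then transport.  (Same extraction as
`Disproof.lean` §11 `isH0Stable_ann_detPoly`.) [folklore] -/
theorem isH0Stable_ann_perPoly (n : ℕ) [NeZero n] :
    ∀ A : Matrix.GeneralLinearGroup (Fin n × Fin n) ℂ,
      let M : Matrix (Fin n × Fin n) (Fin n × Fin n) ℂ := A
      let rk := fun (p : Fin n × Fin n) =>
        (if (n - n ≤ (p.1 : ℕ) ∧ n - n ≤ (p.2 : ℕ)) ∨ p = (0, 0) then 0 else n * n) +
          ((p.1 : ℕ) * n + (p.2 : ℕ))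
      (∀ i j : Fin n × Fin n, M j i ≠ 0 → rk j ≤ rk i) →
      (∀ i j : Fin n × Fin n, ((n - n ≤ (i.1 : ℕ) ∧ n - n ≤ (i.2 : ℕ)) ∨ i = (0, 0)) → j ≠ i → M j i = 0) →
      (∀ i k j l : Fin n, n - n ≤ (i : ℕ) → n - n ≤ (k : ℕ) → n - n ≤ (j : ℕ) → n - n ≤ (l : ℕ) →
        M (i, j) (i, j) * M (k, l) (k, l) = M (i, l) (i, l) * M (k, j) (k, j)) →
      M (0, 0) (0, 0) ^ (n - n) * ∏ i ∈ Finset.univ.filter (fun i : Fin n => n - n ≤ (i : ℕ)), M (i, i) (i, i) = 1 →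
      ∀ k ≤ n, ∀ D ∈ (fun k => annihilatorOfDegree (perPoly (Fin n) ℂ) k) k,
        linSubst (Fin n × Fin n) ℂ Mᵀ D ∈ (fun k => annihilatorOfDegree (perPoly (Fin n) ℂ) k) k := by
  intro A M rk _ hU hR1 _ k _ D hD
  -- `M` is diagonal
  have hdiag : ∀ i j : Fin n × Fin n, j ≠ i → M j i = 0 := fun i j hji =>
    hU i j (Or.inl ⟨by simp, by simp⟩) hji
  have hMeq : M = Matrix.diagonal fun p => M p p := by
    ext j i
    by_cases h : j = i
    · subst h; rw [Matrix.diagonal_apply_eq]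
    · rw [Matrix.diagonal_apply_ne _ h, hdiag i j h]
  -- diagonal entries are nonzero (`A` is invertible)
  have hdet : M.det ≠ 0 := by
    have : IsUnit M.det := by
      rw [show M = (A : Matrix (Fin n × Fin n) (Fin n × Fin n) ℂ) from rfl, ← Matrix.isUnit_iff_isUnit_det]
      exact Units.isUnit A
    exact this.ne_zero
  have hne : ∀ p : Fin n × Fin n, M p p ≠ 0 := by
    rw [hMeq, Matrix.det_diagonal, Finset.prod_ne_zero_iff] at hdet
    intro p
    simpa using hdet p (Finset.mem_univ p)
  -- rank one: `M_(i,j) = a_i b_j` with `a_i = M_(i,0)`, `b_j = M_(0,j) / M_(0,0)`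
  set a : Fin n → ℂ := fun i => M (i, 0) (i, 0) with ha
  set b : Fin n → ℂ := fun j => M (0, j) (0, j) / M (0, 0) (0, 0) with hb
  have hab : ∀ i j : Fin n, M (i, j) (i, j) = a i * b j := by
    intro i j
    have h := hR1 i 0 j 0 (by simp) (by simp) (by simp) (by simp)
    rw [ha, hb]
    field_simp [hne (0, 0)]
    linear_combination h
  have hMt : M = Matrix.diagonal fun p : Fin n × Fin n => a p.1 * b p.2 := by
    rw [hMeq]
    congr 1
    funext p
    exact hab p.1 p.2
  have ha0 : ∀ i, a i ≠ 0 := fun i => hne (i, 0)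
  have hb0 : ∀ j, b j ≠ 0 := fun j => div_ne_zero (hne (0, j)) (hne (0, 0))
  -- transport
  refine ⟨?_, ?_⟩
  · rw [hMt, Matrix.diagonal_transpose]
    exact linSubst_isHomogeneous _ hD.1
  · rw [hMt, Matrix.diagonal_transpose]
    exact apolarAction_rankOneDiag_perPoly hD.2 ha0 hb0

/-! ## The abstract pure witness at `(n, n)` and the falsity of the border-free climb -/

/-- **The abstract pure witness at the corner `m = n`**: `J k := Ann_k(per_n)` satisfies W4, W5, N1,
N2, N3 of the climb.  N1 is `dim Ann_k(per_n) = C(n²+k-1,k) - C(n,k)²` (`flatteningRank_perPoly`: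
the Hilbert functions of `per_n^⊥` and `det_n^⊥` coincide); N3 follows from N1 + W4 by the landed
`stub_h0Elementary` and `stub_conePurity`. [folklore] -/
theorem abstractPureWitness_self (n : ℕ) [NeZero n] : AbstractPureWitnessExists n n := by
  classical
  set J : ℕ → Set (MvPolynomial (Fin n × Fin n) ℂ) := fun k => annihilatorOfDegree (perPoly (Fin n) ℂ) k
    with hJ
  have hW4 := isH0Stable_ann_perPoly n
  -- N1
  have hN1 : ∀ k ≤ n, ∃ Jk : Submodule ℂ (MvPolynomial (Fin n × Fin n) ℂ),
      (Jk : Set (MvPolynomial (Fin n × Fin n) ℂ)) = J k ∧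
      Jk ≤ MvPolynomial.homogeneousSubmodule (Fin n × Fin n) ℂ k ∧
      Module.finrank ℂ Jk = Nat.choose (n * n + k - 1) k - (Nat.choose n k) ^ 2 := by
    intro k _
    obtain ⟨A, hA, hle, hdim⟩ := exists_annSubmodule k (perPoly (Fin n) ℂ)
    refine ⟨A, hA, hle, ?_⟩
    rw [Fintype.card_prod, Fintype.card_fin, flatteningRank_perPoly] at hdim
    exact Nat.eq_sub_of_add_eq hdim
  refine ⟨J, hW4, ?_, hN1, ?_, ?_⟩
  · -- W5
    intro k _ D hD
    rw [paddedPerPoly_self]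
    exact hD.2
  · -- N2
    intro k _ D hD i
    rw [mul_comm]
    exact X_mul_mem_annihilatorOfDegree i hD
  · -- N3, from N1 + W4 via the landed `stub_h0Elementary` and `stub_conePurity`
    intro k hk hbudget D hD hzfree
    obtain ⟨Jk, hcar, hle, hdim⟩ := hN1 k hk
    have hmem : ∀ {E : MvPolynomial (Fin n × Fin n) ℂ}, E ∈ Jk ↔ E ∈ J k := fun {E} => by
      rw [← SetLike.mem_coe, hcar]
    obtain ⟨hzif, htor⟩ := stub_h0Elementary n n J hW4 k hk
    refine stub_conePurity n n k Jk (fun E hE => ?_) (fun y z hy hz c' E hE => ?_)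
      (fun z hz d hd E hE => ?_) hdim hbudget D (hmem.2 hD) hzfree
    · exact (MvPolynomial.mem_homogeneousSubmodule k E).1 (hle hE)
    · exact hmem.2 (hzif y z hy hz c' E (hmem.1 hE))
    · exact hmem.2 (htor z hz d hd E (hmem.1 hE))

/-- `n` lies in its own window for every `c ≥ 1`: `n ≤ 2^((log₂ n + c)^c)`. [folklore] -/
theorem self_le_window (n c : ℕ) (hc : 1 ≤ c) : n ≤ 2 ^ ((Nat.log 2 n + c) ^ c) := by
  have h1 : n < 2 ^ (Nat.log 2 n + 1) := Nat.lt_pow_succ_log_self (by norm_num) n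
  have h2 : Nat.log 2 n + 1 ≤ (Nat.log 2 n + c) ^ c :=
    (Nat.add_le_add_left hc _).trans (Nat.le_self_pow (by omega) _)
  exact h1.le.trans (Nat.pow_le_pow_right (by norm_num) h2)

/-- **Every slice `c ≥ 1` of the border-free climb is false** (witness: `m = n`, `J = Ann(per_n)`),
whereas slice `c = 1` of the climb is a theorem (LMR13) and `c ≥ 2` is its open content. [folklore] -/
theorem not_pureBorderObstructionWithoutBorder_slice (c : ℕ) (hc : 1 ≤ c) :
    ¬ ∃ n₀ : ℕ, ∀ n ≥ n₀, ∀ (m : ℕ) [NeZero m], n ≤ m → m ≤ 2 ^ ((Nat.log 2 n + c) ^ c) →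
      ¬ AbstractPureWitnessExists n m := by
  rintro ⟨n₀, hn₀⟩
  haveI : NeZero (max n₀ 1) := ⟨by omega⟩
  exact hn₀ (max n₀ 1) (le_max_left _ _) (max n₀ 1) le_rfl (self_le_window _ c hc)
    (abstractPureWitness_self (max n₀ 1))

/-- **The climb is FALSE without its border clauses W1–W3** (`stub_pureBorderObstruction` of line
`cone-purity-squeeze` with `P t ∈ GL·det_m` and `IsBorderApolarLimit m P J` deleted): already its slice
`c = 1` fails at `m = n` with `J = Ann(per_n)`.  So W1–W3 are jointly load-bearing in the climb: the
conjuncts N1–N3 + W4 + W5 do not even imply the LMR bound. [folklore] -/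
theorem not_pureBorderObstructionWithoutBorder : ¬ PureBorderObstructionWithoutBorder := fun h =>
  not_pureBorderObstructionWithoutBorder_slice 1 le_rfl (h 1)

end

end Summit.ValiantsHypothesis.ValiantsHypothesis.Theorems.FixedWitnessObstructionQP.Negative
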